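import Literature.NumberTheory.EllipticCurves.Sprung2012.ColemanMapSurjectiveProofs
import HarnessLib

/-!
# Sprung 2012 Def. 5.9 / Def. 7.2 at levels `0, 1, 2`, read modulo `(p, T²)`: the constant and linear terms of a Coleman
# value `Col(z) = (L♯, L♭)` in terms of the values of `z` on the Honda points (proofs only, functional model of `ColemanMaps.lean`)

Topic `Literature/NumberTheory/EllipticCurves`, cluster `Sprung2012` (namespace = path). A THEOREMS file (no definition, no
named fact; net Literature debt `0`); part 1 of 2 — the sequel `Sprung2012/ColemanMapJointCokernelProofs.lean` uses these
congruences to compute the COKERNEL of the joint Coleman map `(Col♯, Col♭)` (the exact sequence (SES-KP)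
`0 → H¹_Iw(T) → Λ² → ℤ_p → 0` of Kurihara–Pollack / Lei–Sujatha in the tree's transcription). Cell `bsd-ssimc`, width seat
`cruxlead-stmt-BirchSwinnertonDyer-19875-w2` (gen 8), `--supports` stmt-BirchSwinnertonDyer-22569 (F-α input (α) of the x8 crux
`KatoFineLowerSporadicX8`). Source: F. E. I. Sprung, *Iwasawa theory for elliptic curves at supersingular primes: A pair of
main conjectures*, J. Number Theory **132** (2012) [Sprung2012], Def. 5.9 (p. 1495: `Col = lim← Col_n`), Def. 7.2 (p. 1500:
`Col_0 = (−a_p P¹_0 + P⁰_0, −P¹_0)`, `Col♭_1`), Thm. 2.2 (p. 1487: the Honda relations), with F. Sprung, ANT 11 (2017) §4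
Cor. 4.4 for `u_2 = a_p`, `v_2 = −Φ_p(1+T)`; in the tree `IsColemanPair … z L♯ L♭` ⟺ `∀ n, ω_n ∣ P_{n,c_n}(z) + u_n L♯ + v_n L♭`.

## What is proved (for `z` a functional on `E(K_∞·K_v)` with `IsColemanPair … z L♯ L♭`, Honda system `(c_{−1}, c)`, `p ∣ a_p`)

Writing `ℓ(z) = z(c_{−1})`, `σ₁(z) = ∑_{j<p} j·z(gʲc_1)`, `σ₂(z) = ∑_{j<p²} C(j,p)·z(gʲc_2)`:
* `IsColemanPair.constantCoeff_eq` — **`L♯(0) = −(a_p(a_p−2) − (p−1))·ℓ(z)`, `L♭(0) = −(a_p−2)·ℓ(z)`** (levels `0`, `1`;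
  exactly the unit computation of `ColemanMapSurjectiveProofs`, now EXPORTED): the image of `Col` modulo `T` is the LINE
  `ℤ_p·(a_p(a_p−2)−(p−1), a_p−2)` — the sanity note of `ColemanMapImage.lean` as a theorem;
* `IsColemanPair.natCast_dvd_coeff_one_sharp_add` — **`L♯'(0) ≡ −σ₁(z) (mod p)`** (level `1`: `ω_1 ≡ T^p (mod p)`, the
  coefficient of `T` in `(1+T)ʲ` is `j`);
* `IsColemanPair.natCast_dvd_coeff_one_flat_sub` — **`L♭'(0) ≡ σ₂(z) (mod p)`** (level `2`: `u_2 = a_p ≡ 0`,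
  `v_2 = −Φ_p(1+T) ≡ −T^{p−1}`, `ω_2 ≡ T^{p²}`; the coefficient of `T^p`).
Plumbing (§0–§1): coefficients of `ω_n` in `Λ` (`ω_n ≡ T^{pⁿ} (mod p)`: a multiple of `ω_n` has all coefficients below
degree `pⁿ` divisible by `p`), `ω_1 = T·Φ_p(1+T)`, `coeff_p(Φ_p(1+T)·L) ≡ L'(0)`, and `coeff_pairingSum`
(`coeff_k P_{n,x}(z) = ∑_j C(j,k) z(gʲx)`). HONEST FRAMING: elementary bookkeeping on the tree's own transcription; no parity
or base-field hypothesis; nothing about any curve's Selmer group or BSD is asserted.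

## References
* [Sprung2012] Thm. 2.2 (p. 1487); Def. 3.1 (p. 1489); Def. 5.9 (p. 1495); Def. 7.1–7.2, proof of Prop. 7.3 (p. 1500).
* [Sprung2017] F. Sprung, ANT 11 (2017), §4 Cor. 4.4. [Pollack2003] R. Pollack, Duke Math. J. 118, Thm. 6.17 (`ω_n`).
* Tree: `Sprung2012/{ColemanMaps, ColemanMapSurjectiveProofs (IsColemanPair.isUnit_of_not_dvd), ColemanTwistProofs
  (constantCoeff_eq_zero_of_toIwasawa_cyclotomicOmega_dvd), LocalTowerTraceProofs}.lean`,
  `Sprung2024/ChromaticSmallControlSurjProofs` (`constantCoeff_pairingSum`), `PlusMinusPAdicLFunctionProofs` (`cyclotomicOmega_succ`).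
-/

noncomputable section

open scoped Classical NumberField

open Polynomial Finset

universe u

namespace Literature.NumberTheory.EllipticCurves.Sprung2012

open Literature.NumberTheory.EllipticCurves Literature.NumberTheory.GaloisRepresentations ZpExtension
  Literature.NumberTheory.EllipticCurves.Kobayashi2003 Literature.NumberTheory.EllipticCurves.Sprung2017

/-! ## §0 Coefficient bookkeeping in `Λ = ℤ_p⟦T⟧` -/

section Coeff

variable {p : ℕ} [Fact p.Prime]

/-- The `k`-th coefficient of the image in `Λ` of an integral polynomial is its `k`-th coefficient. [folklore] -/
private theorem coeff_toIwasawa (f : ℤ[X]) (k : ℕ) :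
    PowerSeries.coeff k (toIwasawa p f) = ((f.coeff k : ℤ) : ℤ_[p]) := by
  rw [show toIwasawa p f = ((f.map (Int.castRingHom ℤ_[p]) : ℤ_[p][X]) : PowerSeries ℤ_[p]) from rfl,
    Polynomial.coeff_coe, Polynomial.coeff_map, eq_intCast]

/-- `toIwasawa (C a) = C a`: constants go to constants. [folklore] -/
private theorem toIwasawa_C (a : ℤ) : toIwasawa p (C a) = PowerSeries.C (a : ℤ_[p]) := by
  rw [show toIwasawa p (C a) = (((C a : ℤ[X]).map (Int.castRingHom ℤ_[p]) : ℤ_[p][X]) : PowerSeries ℤ_[p]) from rfl,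
    Polynomial.map_C, eq_intCast, Polynomial.coe_C]

omit [Fact p.Prime] in
/-- `ω_n = (1+T)^{pⁿ} − 1` has `k`-th coefficient `C(pⁿ, k)` for `k ≠ 0`. [cite: Pollack2003, Thm. 6.17 (ω_n)] -/
theorem coeff_cyclotomicOmega_of_ne_zero (n : ℕ) {k : ℕ} (hk : k ≠ 0) :
    (cyclotomicOmega p n).coeff k = ((p ^ n).choose k : ℤ) := by
  rw [cyclotomicOmega, coeff_sub, coeff_X_add_one_pow, coeff_one, if_neg hk, sub_zero]

/-- `p` divides every coefficient of `ω_n = (1+T)^{pⁿ} − 1` below degree `pⁿ` (in `Λ`): `ω_n ≡ T^{pⁿ} (mod p)`.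
[cite: Pollack2003, Thm. 6.17 (ω_n = (1+T)^{p^n} − 1)] -/
theorem natCast_dvd_coeff_toIwasawa_cyclotomicOmega (n : ℕ) {k : ℕ} (hk : k < p ^ n) :
    (p : ℤ_[p]) ∣ PowerSeries.coeff k (toIwasawa p (cyclotomicOmega p n)) := by
  rcases Nat.eq_zero_or_pos k with rfl | hk0
  · rw [PowerSeries.coeff_zero_eq_constantCoeff, constantCoeff_toIwasawa_cyclotomicOmega]
    exact dvd_zero _
  · rw [coeff_toIwasawa, coeff_cyclotomicOmega_of_ne_zero n hk0.ne', Int.cast_natCast]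
    exact Nat.cast_dvd_cast ((Fact.out : p.Prime).dvd_choose_pow hk0.ne' hk.ne)

/-- **A multiple of `ω_n` in `Λ` has all coefficients below degree `pⁿ` divisible by `p`** (`ω_n ≡ T^{pⁿ} (mod p)`).
[cite: Pollack2003, Thm. 6.17 (ω_n = (1+T)^{p^n} − 1)] -/
theorem natCast_dvd_coeff_of_toIwasawa_cyclotomicOmega_dvd {n k : ℕ} (hk : k < p ^ n) {A : IwasawaAlgebra p}
    (h : toIwasawa p (cyclotomicOmega p n) ∣ A) : (p : ℤ_[p]) ∣ PowerSeries.coeff k A := by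
  obtain ⟨q, rfl⟩ := h
  rw [PowerSeries.coeff_mul]
  refine Finset.dvd_sum fun ij hij => ?_
  have hi : ij.1 + ij.2 = k := mem_antidiagonal.mp hij
  exact dvd_mul_of_dvd_left (natCast_dvd_coeff_toIwasawa_cyclotomicOmega n (by omega)) _

/-- `coeff_k (1+T)^j = C(j, k)` in `Λ`. [folklore] -/
private theorem coeff_one_add_X_pow_iwasawa (j k : ℕ) :
    PowerSeries.coeff k ((1 + PowerSeries.X : IwasawaAlgebra p) ^ j) = (j.choose k : ℤ_[p]) := by
  rw [show (1 + PowerSeries.X : IwasawaAlgebra p) ^ j = (((1 + X : ℤ_[p][X]) ^ j : ℤ_[p][X]) : PowerSeries ℤ_[p]) by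
    rw [Polynomial.coe_pow, Polynomial.coe_add, Polynomial.coe_one, Polynomial.coe_X], Polynomial.coeff_coe,
    coeff_one_add_X_pow]

/-- `ω_1 = T · Φ_p(1+T)` in `Λ`. [cite: Pollack2003, Thm. 6.17 (ω_n)] -/
theorem toIwasawa_cyclotomicOmega_one :
    toIwasawa p (cyclotomicOmega p 1) = PowerSeries.X * toIwasawa p ((cyclotomic p ℤ).comp (X + 1)) := by
  have h := cyclotomicOmega_succ p 0
  rw [zero_add, pow_one] at h
  rw [h, map_mul, show cyclotomicOmega p 0 = X by rw [cyclotomicOmega, pow_zero, pow_one, add_sub_cancel_right],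
    show toIwasawa p X = PowerSeries.X by
      rw [show toIwasawa p X = (((X : ℤ[X]).map (Int.castRingHom ℤ_[p]) : ℤ_[p][X]) : PowerSeries ℤ_[p]) from rfl,
        Polynomial.map_X, Polynomial.coe_X]]

/-- The coefficients of `Φ_p(1+T) = ((1+T)^p − 1)/T` in `Λ`: `coeff_k = C(p, k+1)`. [folklore] -/
private theorem coeff_toIwasawa_cyclotomic_comp (k : ℕ) :
    PowerSeries.coeff k (toIwasawa p ((cyclotomic p ℤ).comp (X + 1))) = (p.choose (k + 1) : ℤ_[p]) := by
  rw [← PowerSeries.coeff_succ_X_mul, ← toIwasawa_cyclotomicOmega_one, coeff_toIwasawa,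
    coeff_cyclotomicOmega_of_ne_zero 1 (Nat.succ_ne_zero k), pow_one, Int.cast_natCast]

/-- `coeff_p (Φ_p(1+T) · L) ≡ coeff_1 L (mod p)`: among `C(p, i+1)`, `0 ≤ i ≤ p`, only `i = p − 1` is a unit
mod `p` (`C(p,p) = 1`; `C(p, p+1) = 0`). [folklore] -/
private theorem natCast_dvd_coeff_cyclotomic_comp_mul_sub (L : IwasawaAlgebra p) :
    (p : ℤ_[p]) ∣ PowerSeries.coeff p (toIwasawa p ((cyclotomic p ℤ).comp (X + 1)) * L) - PowerSeries.coeff 1 L := by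
  have hp : p.Prime := Fact.out
  have h1p : 1 ≤ p := hp.one_le
  rw [PowerSeries.coeff_mul, Nat.sum_antidiagonal_eq_sum_range_succ
    (fun i j => PowerSeries.coeff i (toIwasawa p ((cyclotomic p ℤ).comp (X + 1))) * PowerSeries.coeff j L) p,
    ← add_sum_erase _ _ (mem_range.mpr (by omega) : p - 1 ∈ range (p + 1)),
    coeff_toIwasawa_cyclotomic_comp, Nat.sub_add_cancel hp.one_le, Nat.choose_self, Nat.cast_one, one_mul,
    show p - (p - 1) = 1 by omega, add_sub_cancel_left]
  refine dvd_sum fun i hi => ?_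
  rw [mem_erase, mem_range] at hi
  rw [coeff_toIwasawa_cyclotomic_comp]
  refine dvd_mul_of_dvd_left ?_ _
  rcases Nat.lt_or_ge i p with hip | hip
  · exact Nat.cast_dvd_cast (hp.dvd_choose_self (Nat.succ_ne_zero i) (by omega))
  · rw [Nat.choose_eq_zero_of_lt (by omega), Nat.cast_zero]
    exact dvd_zero _

end Coeff

/-! ## §1 Sprung's pairing values: coefficients -/

section Local

variable {K : Type u} [Field K] {p : ℕ} [Fact p.Prime] (κ : ZpExtension K p)
variable {E : Type u} [Field E] [Algebra K E] (ι : AlgebraicClosure K →ₐ[K] AlgebraicClosure E)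
variable (W : WeierstrassCurve K)

/-- The `k`-th coefficient of `P_{n,x}(z) = ∑_{j<pⁿ} z(gʲx)(1+T)ʲ` is `∑_{j<pⁿ} C(j,k)·z(gʲx)`.
[cite: Sprung2012, Def. 3.1 (p. 1489)] -/
theorem coeff_pairingSum (A : AddSubgroup (localPoints W E)) (g : Field.absoluteGaloisGroup E) (n : ℕ)
    (x : localPoints W E) (z : A →+ ℤ_[p]) (k : ℕ) :
    PowerSeries.coeff k (pairingSum W A g n x z) =
      ∑ j ∈ range (p ^ n), (j.choose k : ℤ_[p]) * evalOn W A z (g ^ j • x) := by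
  rw [pairingSum_def, map_sum]
  refine sum_congr rfl fun j _ => ?_
  rw [PowerSeries.coeff_C_mul, coeff_one_add_X_pow_iwasawa, mul_comm]

variable {κ ι W}

/-! ## §2 Levels `0, 1, 2` of the Coleman characterisation, modulo `(p, T²)`

For a functional `z` on `E(K_∞·K_v)` with Coleman value `Col(z) = (L♯, L♭)` (`IsColemanPair … z L♯ L♭`) attached to a
Honda system `(c_{−1}, c)` (`p` odd, `p ∣ a_p`): writing `ℓ(z) = z(c_{−1})`,
`σ₁(z) = ∑_{j<p} j·z(gʲc_1)`, `σ₂(z) = ∑_{j<p²} C(j,p)·z(gʲc_2)`,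
* level `0` (`Col♭_0 = −P_{0,c_0}`): `L♭(0) = −(a_p − 2)·ℓ(z)`;
* level `1` (`Col♯_1 = −P_{1,c_1}`): `L♯(0) = −(a_p(a_p − 2) − (p − 1))·ℓ(z)` and `L♯'(0) ≡ −σ₁(z) (mod p)` (`ω_1 ≡ T^p`);
* level `2` (`ω_2 ∣ P_{2,c_2}(z) + a_p L♯ − Φ_p(1+T) L♭`, `Φ_p(1+T) ≡ T^{p−1}`, `ω_2 ≡ T^{p²}`): `L♭'(0) ≡ σ₂(z) (mod p)`.
-/

/-- **Levels `0` and `1`, constant terms**: `L♯(0) = −(a_p(a_p−2) − (p−1))·z(c_{−1})` and `L♭(0) = −(a_p − 2)·z(c_{−1})`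
(Def. 7.2: `Col♭_0 = −P¹_0`, `Col♯_1 = −P¹_1`; Honda relations `c_0 = (a_p − 2)c_{−1}`, `Tr_{1/0} c_1 = a_p c_0 − (p−1) c_{−1}`).
In particular the image of `Col` modulo `T` is the LINE `ℤ_p·(a_p(a_p−2) − (p−1), a_p − 2)`.
[cite: Sprung2012, Def. 7.2 and proof of Prop. 7.3 (p. 1500), Thm. 2.2 (p. 1487)] -/
theorem IsColemanPair.constantCoeff_eq {ap : ℤ} {g : Field.absoluteGaloisGroup E} (hg : κ.IsTopGenerator (resGalOfEmb ι g))
    {cneg : localPoints W E} {c : ℕ → localPoints W E} (hH : IsHondaSystem κ ι W ap g cneg c)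
    {z : localTowerPointsOfEmb κ ι W →+ ℤ_[p]} {Ls Lf : IwasawaAlgebra p} (hCP : IsColemanPair κ ι W ap g c z Ls Lf) :
    PowerSeries.constantCoeff Ls =
        -(((ap : ℤ_[p]) * ((ap : ℤ_[p]) - 2) - ((p : ℤ_[p]) - 1)) * evalOn W (localTowerPointsOfEmb κ ι W) z cneg) ∧
      PowerSeries.constantCoeff Lf = -(((ap : ℤ_[p]) - 2) * evalOn W (localTowerPointsOfEmb κ ι W) z cneg) := by
  have hcneg := hH.1
  have hc := hH.2.1
  have hc0 := hH.2.2.1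
  have hTr1 := hH.2.2.2.1
  have hle := fun n ↦ localLayerPointsOfEmb_le_localTowerPointsOfEmb κ ι W n
  rw [evalOn_of_mem W _ z (hle 0 hcneg)]
  set u : ℤ_[p] := z ⟨cneg, hle 0 hcneg⟩ with hu
  -- `z(c_0) = (a_p − 2) z(c_{−1})`
  have hzc0 : z ⟨c 0, hle 0 (hc 0)⟩ = ((ap : ℤ_[p]) - 2) * u := by
    have e : (⟨c 0, hle 0 (hc 0)⟩ : localTowerPointsOfEmb κ ι W) = (ap - 2) • ⟨cneg, hle 0 hcneg⟩ :=
      Subtype.ext (by rw [AddSubgroupClass.coe_zsmul]; exact hc0)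
    rw [e, map_zsmul, zsmul_eq_mul, Int.cast_sub, Int.cast_ofNat]
  -- `∑_{j<p} z(gʲ c_1) = z(Tr_{1/0} c_1) = a_p z(c_0) − (p − 1) z(c_{−1})`
  have hTrmem0 : localTraceOfEmb κ ι W 0 1 (c 1) ∈ localLayerPointsOfEmb κ ι W 0 := by
    rw [hTr1]
    exact sub_mem (AddSubgroup.zsmul_mem _ (hc 0) _) (AddSubgroup.zsmul_mem _ hcneg _)
  have hTrmem : localTraceOfEmb κ ι W 0 1 (c 1) ∈ localTowerPointsOfEmb κ ι W := hle 0 hTrmem0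
  have hzTr : z ⟨localTraceOfEmb κ ι W 0 1 (c 1), hTrmem⟩ =
      (ap : ℤ_[p]) * (((ap : ℤ_[p]) - 2) * u) - ((p : ℤ_[p]) - 1) * u := by
    have e : (⟨localTraceOfEmb κ ι W 0 1 (c 1), hTrmem⟩ : localTowerPointsOfEmb κ ι W) =
        ap • ⟨c 0, hle 0 (hc 0)⟩ - ((p : ℤ) - 1) • ⟨cneg, hle 0 hcneg⟩ :=
      Subtype.ext (by rw [AddSubgroupClass.coe_sub, AddSubgroupClass.coe_zsmul, AddSubgroupClass.coe_zsmul]; exact hTr1)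
    rw [e, map_sub, map_zsmul, map_zsmul, zsmul_eq_mul, zsmul_eq_mul, hzc0, Int.cast_sub, Int.cast_natCast, Int.cast_one]
  have hsum : ∑ j ∈ range p, evalOn W (localTowerPointsOfEmb κ ι W) z (g ^ j • c 1) =
      z ⟨localTraceOfEmb κ ι W 0 1 (c 1), hTrmem⟩ := by
    have hmem : ∀ j : ℕ, g ^ j • c 1 ∈ localTowerPointsOfEmb κ ι W := fun j ↦
      smul_mem_localTowerPointsOfEmb κ ι W _ (hle 1 (hc 1))
    have h : (⟨localTraceOfEmb κ ι W 0 1 (c 1), hTrmem⟩ : localTowerPointsOfEmb κ ι W) =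
        ∑ j ∈ range p, ⟨g ^ j • c 1, hmem j⟩ := by
      apply Subtype.ext
      change localTraceOfEmb κ ι W 0 1 (c 1) =
        ((∑ j ∈ range p, (⟨g ^ j • c 1, hmem j⟩ : localTowerPointsOfEmb κ ι W) :
          localTowerPointsOfEmb κ ι W) : localPoints W E)
      rw [AddSubmonoidClass.coe_finsetSum, localTraceOfEmb_succ_eq_sum_pow_smul κ ι W hg 0 (hc 1)]
      refine sum_congr rfl fun j _ => ?_
      rw [pow_zero, one_mul]
    rw [h, map_sum]
    exact sum_congr rfl fun j _ => evalOn_of_mem W _ z (hmem j)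
  constructor
  · -- level 1: `z(Tr_{1/0} c_1) + L♯(0) = 0`
    have h := hCP 1
    rw [sharpPoly_one, flatPoly_one, map_one, map_zero, one_mul, zero_mul, add_zero] at h
    have h' := constantCoeff_eq_zero_of_toIwasawa_cyclotomicOmega_dvd h
    rw [map_add, constantCoeff_pairingSum, pow_one, hsum, hzTr] at h'
    rw [eq_neg_of_add_eq_zero_right h']
    ring
  · -- level 0: `z(c_0) + L♭(0) = 0`
    have h := hCP 0
    rw [sharpPoly_zero, flatPoly_zero, map_zero, map_one, zero_mul, one_mul, zero_add] at h
    have h' := constantCoeff_eq_zero_of_toIwasawa_cyclotomicOmega_dvd h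
    rw [map_add, constantCoeff_pairingSum] at h'
    simp only [pow_zero, sum_range_one, one_smul] at h'
    rw [evalOn_of_mem W _ z (hle 0 (hc 0)), hzc0] at h'
    exact eq_neg_of_add_eq_zero_right h'

/-- **Level `1`, linear term**: `p ∣ L♯'(0) + ∑_{j<p} j·z(gʲ c_1)` — from `ω_1 ∣ P_{1,c_1}(z) + L♯` (`u_1 = 1`, `v_1 = 0`)
and `ω_1 ≡ T^p (mod p)`, the coefficient of `T` in `(1+T)ʲ` being `j`. [cite: Sprung2012, Def. 5.9 (p. 1495), Def. 7.2 (p. 1500)] -/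
theorem IsColemanPair.natCast_dvd_coeff_one_sharp_add {ap : ℤ} {g : Field.absoluteGaloisGroup E}
    {c : ℕ → localPoints W E} {z : localTowerPointsOfEmb κ ι W →+ ℤ_[p]} {Ls Lf : IwasawaAlgebra p}
    (hCP : IsColemanPair κ ι W ap g c z Ls Lf) :
    (p : ℤ_[p]) ∣ PowerSeries.coeff 1 Ls +
      ∑ j ∈ range p, (j : ℤ_[p]) * evalOn W (localTowerPointsOfEmb κ ι W) z (g ^ j • c 1) := by
  have hp : p.Prime := Fact.out
  have h := hCP 1
  rw [sharpPoly_one, flatPoly_one, map_one, map_zero, one_mul, zero_mul, add_zero] at h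
  have h' := natCast_dvd_coeff_of_toIwasawa_cyclotomicOmega_dvd (n := 1) (k := 1) (by rw [pow_one]; exact hp.one_lt) h
  rw [map_add, coeff_pairingSum, pow_one, add_comm] at h'
  simp_rw [Nat.choose_one_right] at h'
  exact h'

/-- **Level `2`, linear term of the flat value**: `p ∣ L♭'(0) − ∑_{j<p²} C(j,p)·z(gʲ c_2)` — from
`ω_2 ∣ P_{2,c_2}(z) + u_2 L♯ + v_2 L♭` with `u_2 = a_p ≡ 0`, `v_2 = −Φ_p(1+T) ≡ −T^{p−1}` and `ω_2 ≡ T^{p²} (mod p)`: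
the coefficient of `T^p` reads `∑_j C(j,p) z(gʲc_2) − L♭'(0) ≡ 0`. [cite: Sprung2012, Def. 5.9 (p. 1495)] [cite: Sprung2017, §4 Cor. 4.4 (u_2, v_2)] -/
theorem IsColemanPair.natCast_dvd_coeff_one_flat_sub {ap : ℤ} (hap : (p : ℤ) ∣ ap) {g : Field.absoluteGaloisGroup E}
    {c : ℕ → localPoints W E} {z : localTowerPointsOfEmb κ ι W →+ ℤ_[p]} {Ls Lf : IwasawaAlgebra p}
    (hCP : IsColemanPair κ ι W ap g c z Ls Lf) :
    (p : ℤ_[p]) ∣ PowerSeries.coeff 1 Lf -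
      ∑ j ∈ range (p ^ 2), (j.choose p : ℤ_[p]) * evalOn W (localTowerPointsOfEmb κ ι W) z (g ^ j • c 2) := by
  have hp : p.Prime := Fact.out
  have h := hCP 2
  rw [sharpPoly_two, flatPoly_two, pow_one, map_neg, toIwasawa_C] at h
  have hk : p < p ^ 2 := by rw [sq]; exact lt_mul_self hp.one_lt
  have h' := natCast_dvd_coeff_of_toIwasawa_cyclotomicOmega_dvd hk h
  rw [map_add, map_add, coeff_pairingSum, PowerSeries.coeff_C_mul, neg_mul, map_neg] at h'
  have h2 := natCast_dvd_coeff_cyclotomic_comp_mul_sub (p := p) Lf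
  have h3 : (p : ℤ_[p]) ∣ (ap : ℤ_[p]) * PowerSeries.coeff p Ls := by
    obtain ⟨b, rfl⟩ := hap
    rw [Int.cast_mul, Int.cast_natCast, mul_assoc]
    exact dvd_mul_right _ _
  have key := dvd_sub (dvd_add (dvd_neg.mpr h') h3) h2
  convert key using 1
  ring

end Local

end Literature.NumberTheory.EllipticCurves.Sprung2012

end
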